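import Mathlib.GroupTheory.FreeGroup.NielsenSchreier
import Mathlib.GroupTheory.PGroup
import Mathlib.Analysis.SpecificLimits.Normed
import Literature.AnabelianGeometry.SemiGraphs.ProSigmaPuncturedSlim
import Literature.AnabelianGeometry.SemiGraphs.ProSigmaCompletionRestrict
import Literature.AnabelianGeometry.SemiGraphs.ProSigmaCompletionProfiniteExtend
import Literature.GroupTheory.CombinatorialGroupTheory.SchreierIndexFormulaRank
import Literature.AnabelianGeometry.AbsoluteAnabelian.AbsTopISemiAbsolute
import Literature.AnabelianGeometry.AbsoluteAnabelian.ProfiniteElasticCriterionAffineProofs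
import Literature.AnabelianGeometry.AbsoluteAnabelian.ProfiniteRankProofs
import Literature.AnabelianGeometry.AbsoluteAnabelian.FreeProlRankCompletionProofs
import HarnessLib

/-!
# Pro-`Σ` completions of nonabelian free groups are elastic ([AbsTopI] Prop 2.3 (i), affine model)

S. Mochizuki, *Topics in Absolute Anabelian Geometry I: Generalities* (2012) [AbsTopI] (lit key
`paper:url-11ac98ba15fc`), Prop 2.3 (i) p. 19: "`Δ` is slim and elastic" for the geometric fundamental
group `Δ` of a hyperbolic orbicurve — for an AFFINE hyperbolic curve of type `(g, r)`, `r ≥ 1`, `Δ`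
is the pro-`Σ` completion of the punctured surface group `Γ_{g,r}`, free of rank `2g + r − 1 ≥ 2`.
abc-iut cell FACT-LIST F-0239 (`GeomSlimElastic`), L4-lead RULING #4g piece (iii) (the punctured /
free half at the model; the closed-surface half (ii) is abc-iut-L4-d1's, the affine elasticity
criterion (i) is abc-iut-L4-t15's p422746 `isElastic_of_affine_rankFormula`, whose key lemma is
abc-iut-w5-d206's `freeProlRank_le_add_of_sup_zpowers`).

THIS PROOF-ONLY FILE (no definitions, no named facts):

* (private) `index_comap_of_isOpen'` — `[Γ : ι⁻¹ U] = [P : U]` for every OPEN `U` (= abc-iut-L4-d1's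
  `IsProSigmaCompletion.index_comap_of_isOpen`, p423697, restated privately: that module was unbuilt);
* `isSigmaInteger_index_padicPi` — open subgroups of `ℤ_ℓ^m` have `ℓ`-power, hence `Σ`-integer,
  index (`ℓⁿ x → 0`, so the finite quotient is an `ℓ`-group);
* `freeProlRank_eq_card_of_isProSigmaCompletion_freeGroup` — for `ι : F(α) → P` a pro-`Σ` completion
  (`P` profinite), `α` finite, `ℓ ∈ Σ`: **`δ¹_ℓ(P) = |α|`** (≤: topological generation by the images
  of the letters, `freeProlRank_le_card`; ≥: `F(α) → ℤ^α ⊆ ℤ_ℓ^α` has dense image and extends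
  continuously to `P` — universal property for profinite pro-`Σ` targets — with full image);
* `freeProlRank_eq_of_isOpen_of_isProSigmaCompletion_freeGroup` — for `U ⊆ P` open,
  **`δ¹_ℓ(U) = (|α| − 1)·[P : U] + 1`** (`U` is the pro-`Σ` completion of `ι⁻¹U` (`restrict`), which is
  free of that rank by Nielsen–Schreier + the tree's SCHREIER index formula);
* `isElastic_of_isProSigmaCompletion_freeGroup` / `…_puncturedSurfaceGroup` — **`P` is ELASTIC** for
  `|α| ≥ 2` (resp. `(g, r)` hyperbolic, `r ≥ 1`) by the affine rank criterion (`c = |α| − 1`, `e = 1`;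
  abc-iut-L4-t15's `isElastic_of_affine_rankFormula`, p422746); `…_of_crit` variants carry the criterion
  as an explicit hypothesis `hcrit` (the shape agreed in L4-lead RULING #4g);
* `slim_and_elastic_of_isProSigmaCompletion_puncturedSurfaceGroup` — with the landed slim half:
  «slim ∧ elastic» at the affine model, UNCONDITIONAL.

HONEST SCOPE: model-level (pro-`Σ` completions of free / punctured surface groups); the abstract
hypothesis `GeomSlimElastic` of the typed Prop 2.3 (i) stays a hypothesis elsewhere; the elasticity
route is the cell's rank criterion, NOT the printed one ([AbsTopI] cites [MT] Thm 1.5).  Classical;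
nothing here bears on [IUTchIII] Cor. 3.12.
-/

noncomputable section

open Topology Filter

namespace Literature.AnabelianGeometry.SemiGraphs.SemiGraphOfAnabelioids

open Literature.AnabelianGeometry.Anabelioids Literature.AnabelianGeometry.AbsoluteAnabelian
  Literature.AlgebraicGeometry.Frobenioids Literature.GroupTheory.CombinatorialGroupTheory

universe u v

namespace IsProSigmaCompletion

variable {Sigma : Set ℕ} {Γ : Type u} [Group Γ] {P : Type v} [Group P] [TopologicalSpace P]
  [IsTopologicalGroup P] {ι : Γ →* P}

/-- **`[Γ : ι⁻¹ U] = [P : U]` for an OPEN subgroup `U`** (not necessarily normal): the map of left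
coset spaces `Γ/ι⁻¹U → P/U` is injective by definition and surjective because every coset `x U` meets
the dense image `ι(Γ)` (`exists_mem_coset`).  PRIVATE COPY of abc-iut-L4-d1's
`IsProSigmaCompletion.index_comap_of_isOpen` (ProSigmaSurfaceFreeProlRank.lean, p423697 — that
module's olean was not yet built when this file was checked; same statement).
[cite: MochizukiSemiAnbd2006, Ex. 2.10 p.31] -/
private theorem index_comap_of_isOpen' (hι : IsProSigmaCompletion Sigma ι) (U : Subgroup P)
    (hU : IsOpen (U : Set P)) : (U.comap ι).index = U.index := by
  classical
  let f : Γ ⧸ U.comap ι → P ⧸ U :=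
    Quotient.map' ι fun a b h => by
      rw [QuotientGroup.leftRel_apply] at h ⊢
      rw [Subgroup.mem_comap, map_mul, map_inv] at h
      exact h
  have hf : Function.Bijective f := by
    constructor
    · intro a b hab
      induction a using QuotientGroup.induction_on with | H a =>
      induction b using QuotientGroup.induction_on with | H b =>
      have hab' : (QuotientGroup.mk (ι a) : P ⧸ U) = QuotientGroup.mk (ι b) := hab
      rw [QuotientGroup.eq] at hab' ⊢
      rw [Subgroup.mem_comap, map_mul, map_inv]
      exact hab'
    · intro q
      induction q using QuotientGroup.induction_on with | H x =>
      obtain ⟨γ, hγ⟩ := exists_mem_coset hι U hU x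
      refine ⟨QuotientGroup.mk γ, ?_⟩
      change (QuotientGroup.mk (ι γ) : P ⧸ U) = QuotientGroup.mk x
      rw [eq_comm, QuotientGroup.eq]
      exact hγ
  rw [Subgroup.index, Subgroup.index]
  exact Nat.card_congr (Equiv.ofBijective f hf)

end IsProSigmaCompletion

/-! ### Open subgroups of `ℤ_ℓ^m` -/

/-- **Open subgroups of `ℤ_ℓ^m` have `Σ`-integer index** (`ℓ ∈ Σ`): for `x ∈ ℤ_ℓ^m`, `ℓⁿ • x → 0`,
so `ℓⁿ • x` lies in the open subgroup `V` for large `n`; hence the finite quotient `ℤ_ℓ^m / V` is an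
`ℓ`-group and `[ℤ_ℓ^m : V]` is a power of `ℓ`. [cite: MochizukiSemiAnbd2006, Ex. 2.10 p.31] -/
theorem isSigmaInteger_index_padicPi {Sigma : Set ℕ} {m ℓ : ℕ} [hℓp : Fact ℓ.Prime] (hℓ : ℓ ∈ Sigma)
    (V : Subgroup (Multiplicative (Fin m → ℤ_[ℓ])))
    (hV : IsOpen (V : Set (Multiplicative (Fin m → ℤ_[ℓ])))) :
    IsSigmaInteger Sigma V.index := by
  classical
  haveI : Finite (Multiplicative (Fin m → ℤ_[ℓ]) ⧸ V) := Subgroup.quotient_finite_of_isOpen V hV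
  haveI : V.Normal := inferInstance
  -- the quotient is an `ℓ`-group
  have hP : IsPGroup ℓ (Multiplicative (Fin m → ℤ_[ℓ]) ⧸ V) := by
    intro q
    obtain ⟨x, rfl⟩ := QuotientGroup.mk_surjective q
    -- `ℓⁿ • x → 0`
    have ht : Tendsto (fun n : ℕ => Multiplicative.ofAdd (((ℓ : ℤ_[ℓ]) ^ n) • Multiplicative.toAdd x))
        atTop (𝓝 1) := by
      have h0 : Tendsto (fun n : ℕ => ((ℓ : ℤ_[ℓ]) ^ n)) atTop (𝓝 0) :=
        tendsto_pow_atTop_nhds_zero_of_norm_lt_one (by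
          rw [PadicInt.norm_p]
          exact inv_lt_one_of_one_lt₀ (by exact_mod_cast hℓp.out.one_lt))
      have h1 : Tendsto (fun n : ℕ => ((ℓ : ℤ_[ℓ]) ^ n) • Multiplicative.toAdd x) atTop (𝓝 0) := by
        simpa using h0.smul_const (Multiplicative.toAdd x)
      exact (continuous_ofAdd.tendsto _).comp h1
    have hmem : ∀ᶠ n : ℕ in atTop,
        Multiplicative.ofAdd (((ℓ : ℤ_[ℓ]) ^ n) • Multiplicative.toAdd x) ∈ V :=
      ht (hV.mem_nhds V.one_mem)
    obtain ⟨n, hn⟩ := hmem.exists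
    refine ⟨n, ?_⟩
    rw [← QuotientGroup.mk_pow, QuotientGroup.eq_one_iff]
    have hx : Multiplicative.ofAdd (((ℓ : ℤ_[ℓ]) ^ n) • Multiplicative.toAdd x) = x ^ ℓ ^ n := by
      rw [← Nat.cast_pow, Nat.cast_smul_eq_nsmul, ofAdd_nsmul, ofAdd_toAdd]
    rw [← hx]
    exact hn
  obtain ⟨n, hn⟩ := IsPGroup.iff_card.mp hP
  rw [Subgroup.index_eq_card, hn]
  refine ⟨pow_pos hℓp.out.pos n, fun p hp hpd => ?_⟩
  rw [(Nat.prime_dvd_prime_iff_eq hp hℓp.out).mp (hp.dvd_of_dvd_pow hpd)]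
  exact hℓ

/-! ### The free pro-`ℓ` rank of a pro-`Σ` completion of a free group -/

section FreeGroupRank

variable {Sigma : Set ℕ} {α : Type u} [Fintype α]
  {P : Type v} [Group P] [TopologicalSpace P] [IsTopologicalGroup P] [CompactSpace P]
  [TotallyDisconnectedSpace P] {ι : FreeGroup α →* P}

omit [TotallyDisconnectedSpace P] in
/-- **`δ¹_ℓ(P) = |α|` for a pro-`Σ` completion `ι : F(α) → P` of the free group on a finite set `α`,
`ℓ ∈ Σ` prime.**  (≤) `P` is topologically generated by the `|α|` elements `ι(a)`; (≥) the
homomorphism `F(α) → ℤ_ℓ^α`, `a ↦ e_a`, has dense image (it contains `ℕ^α`) and extends along `ι` to a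
continuous homomorphism `P → ℤ_ℓ^α` (universal property of the pro-`Σ` completion for profinite pro-`Σ`
targets), whose compact dense image is everything. [cite: MochizukiSemiAnbd2006, Ex. 2.10 p.31] -/
theorem freeProlRank_eq_card_of_isProSigmaCompletion_freeGroup (hι : IsProSigmaCompletion Sigma ι)
    {ℓ : ℕ} [Fact ℓ.Prime] (hℓ : ℓ ∈ Sigma) :
    freeProlRank P ℓ = (Fintype.card α : ℕ∞) := by
  classical
  refine le_antisymm ?_ ?_
  · -- (≤) topological generation by `ι(a)`, `a ∈ α`
    let s : Finset P := Finset.univ.image fun a : α => ι (FreeGroup.of a)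
    have hs : (Subgroup.closure (s : Set P)).topologicalClosure = ⊤ := by
      have hcl : Subgroup.closure (s : Set P) = ι.range := by
        have : (s : Set P) = ι '' Set.range (FreeGroup.of : α → FreeGroup α) := by
          ext y
          simp only [s, Finset.coe_image, Finset.coe_univ, Set.image_univ, Set.mem_range,
            Set.mem_image, exists_exists_eq_and]
        rw [this, ← MonoidHom.map_closure, FreeGroup.closure_range_of α, ← MonoidHom.range_eq_map]
      rw [hcl, eq_top_iff]
      intro x _
      have hx : x ∈ closure (Set.range ι) := by rw [hι.dense.closure_eq]; trivial
      exact hx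
    calc freeProlRank P ℓ ≤ (s.card : ℕ∞) := freeProlRank_le_card s hs ℓ
      _ ≤ (Fintype.card α : ℕ∞) := by
        exact_mod_cast (Finset.card_image_le.trans (by rw [Finset.card_univ]))
  · -- (≥) a continuous surjection `P ↠ ℤ_ℓ^n`, `n = |α|`
    set n : ℕ := Fintype.card α with hn
    let eα : α ≃ Fin n := Fintype.equivFin α
    let B := Multiplicative (Fin n → ℤ_[ℓ])
    let f : FreeGroup α →* B :=
      FreeGroup.lift fun a => Multiplicative.ofAdd (Pi.single (eα a) (1 : ℤ_[ℓ]))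
    have hf : ∀ a, f (FreeGroup.of a) = Multiplicative.ofAdd (Pi.single (eα a) (1 : ℤ_[ℓ])) :=
fun a => FreeGroup.lift_apply_of
    have hB : ∀ V : Subgroup B, V.Normal → IsOpen (V : Set B) → IsSigmaInteger Sigma V.index :=
      fun V _ hVo => isSigmaInteger_index_padicPi hℓ V hVo
    obtain ⟨F, hFc, hFι⟩ := hι.exists_continuous_extend_profinite hB f
    -- `range F ⊇ range f ⊇ ℕ^n`, which is dense
    have hsub : Set.range (fun w : Fin n → ℕ => Multiplicative.ofAdd (fun i => (w i : ℤ_[ℓ]))) ⊆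
        Set.range F := by
      rintro _ ⟨w, rfl⟩
      have hmem : Multiplicative.ofAdd (fun i => (w i : ℤ_[ℓ])) ∈ f.range := by
        have hw : (fun i => (w i : ℤ_[ℓ])) = ∑ i, (Pi.single i ((w i : ℤ_[ℓ])) : Fin n → ℤ_[ℓ]) := by
          ext j
          rw [Finset.sum_apply, Finset.sum_eq_single j (fun i _ hij => Pi.single_eq_of_ne' hij _)
            (fun h => absurd (Finset.mem_univ j) h), Pi.single_eq_same]
        rw [hw, ofAdd_sum]
        refine Subgroup.prod_mem _ fun i _ => ?_
        have : Multiplicative.ofAdd (Pi.single i ((w i : ℤ_[ℓ])) : Fin n → ℤ_[ℓ]) =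
            (Multiplicative.ofAdd (Pi.single i (1 : ℤ_[ℓ]) : Fin n → ℤ_[ℓ])) ^ (w i) := by
          rw [← ofAdd_nsmul, ← Pi.single_smul, nsmul_eq_mul, mul_one]
        rw [this]
        exact Subgroup.pow_mem _ (MonoidHom.mem_range.mpr
          ⟨FreeGroup.of (eα.symm i), by rw [hf, Equiv.apply_symm_apply]⟩) _
      obtain ⟨x, hx⟩ := hmem
      exact ⟨ι x, by rw [hFι, hx]⟩
    have hdenseN : DenseRange (fun w : Fin n → ℕ => Multiplicative.ofAdd (fun i => (w i : ℤ_[ℓ]))) := by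
      have h1 : DenseRange (fun w : Fin n → ℕ => (fun i => (w i : ℤ_[ℓ]))) := by
        change DenseRange (Pi.map fun _ : Fin n => (Nat.cast : ℕ → ℤ_[ℓ]))
        rw [DenseRange, Set.range_piMap]
        exact dense_pi Set.univ fun i _ => PadicInt.denseRange_natCast
      exact (Multiplicative.ofAdd.surjective.denseRange).comp h1 continuous_ofAdd
    have hdense : Dense (Set.range F) := hdenseN.mono hsub
    have hsurj : Function.Surjective F := by
      have hclosed : IsClosed (Set.range F) := (isCompact_range hFc).isClosed
      exact Set.range_eq_univ.mp (by rw [← hclosed.closure_eq, hdense.closure_eq])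
    exact le_freeProlRank_of_surjective ℓ ⟨F, hFc⟩ hsurj

/-- **`δ¹_ℓ(U) = (|α| − 1)·[P : U] + 1` for an open subgroup `U`** of a pro-`Σ` completion `P` of
`F(α)` (`α` finite, nonempty; `ℓ ∈ Σ`): `U` is the pro-`Σ` completion of `ι⁻¹U` (`restrict`), a free
group (Nielsen–Schreier) of rank `(|α| − 1)[Γ : ι⁻¹U] + 1` (Schreier's index formula), and
`[Γ : ι⁻¹U] = [P : U]`. [cite: MochizukiAbsTopI2012, Prop 2.3 (i) p.19] -/
theorem freeProlRank_eq_of_isOpen_of_isProSigmaCompletion_freeGroup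
    (hι : IsProSigmaCompletion Sigma ι) {ℓ : ℕ} [Fact ℓ.Prime] (hℓ : ℓ ∈ Sigma)
    (hα : 1 ≤ Fintype.card α) (U : Subgroup P) (hU : IsOpen (U : Set P)) :
    freeProlRank U ℓ = (((Fintype.card α - 1) * U.index + 1 : ℕ) : ℕ∞) := by
  classical
  -- `ι⁻¹U`: finite index, free (Nielsen–Schreier), with finitely many free generators (Schreier)
  let Γ' : Subgroup (FreeGroup α) := U.comap ι
  haveI : Γ'.FiniteIndex := hι.finiteIndex_comap U hU
  have hSch := (FreeGroup.card_generators_add_index (α := α) Γ').1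
  rw [Nat.card_eq_fintype_card (α := α)] at hSch
  have hidx : 0 < Γ'.index := Nat.pos_of_ne_zero Subgroup.FiniteIndex.index_ne_zero
  obtain ⟨k, hk⟩ : ∃ k, Fintype.card α = k + 1 := ⟨Fintype.card α - 1, by omega⟩
  rw [hk, Nat.mul_succ] at hSch
  have hgens : Nat.card (IsFreeGroup.Generators Γ') = k * Γ'.index + 1 := by
    rw [Nat.mul_comm]; omega
  have hne : Nat.card (IsFreeGroup.Generators Γ') ≠ 0 := by omega
  haveI : Finite (IsFreeGroup.Generators Γ') := Nat.finite_of_card_ne_zero hne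
  letI : Fintype (IsFreeGroup.Generators Γ') := Fintype.ofFinite _
  -- `U` (compact) is the pro-`Σ` completion of `ι⁻¹U ≅ F(Generators ι⁻¹U)`
  haveI : CompactSpace U := isCompact_iff_compactSpace.mp (U.isClosed_of_isOpen hU).isCompact
  have hres : IsProSigmaCompletion Sigma (ι.subgroupComap U) := hι.restrict U hU
  let e : FreeGroup (IsFreeGroup.Generators Γ') ≃* Γ' := (IsFreeGroup.toFreeGroup Γ').symm
  have hres' : IsProSigmaCompletion Sigma ((ι.subgroupComap U).comp e.toMonoidHom) :=
    hres.of_comp_mulEquiv e (fun _ => rfl)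
  rw [freeProlRank_eq_card_of_isProSigmaCompletion_freeGroup hres' hℓ, ← Nat.card_eq_fintype_card,
    hgens, ← IsProSigmaCompletion.index_comap_of_isOpen' hι U hU, hk, Nat.add_sub_cancel]

end FreeGroupRank



/-! ### Elasticity -/

section Elastic

variable {Sigma : Set ℕ} {P : Type v} [Group P] [TopologicalSpace P] [IsTopologicalGroup P]
  [CompactSpace P] [T2Space P] [TotallyDisconnectedSpace P]

/-- **Pro-`Σ` completions of free groups of finite rank `≥ 2` are ELASTIC**, GIVEN the affine rank
criterion `hcrit` (abc-iut-L4-t15's `isElastic_of_affine_rankFormula`, p422746, stated here in exactly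
its shape): every open subgroup `U` has `δ¹_ℓ(U) = (|α| − 1)·[P : U] + 1` with `|α| − 1 ≥ 1`.
[cite: MochizukiAbsTopI2012, Prop 2.3 (i) p.19] -/
theorem isElastic_of_isProSigmaCompletion_freeGroup_of_crit
    (hcrit : ∀ (Q : Type v) [Group Q] [TopologicalSpace Q] [IsTopologicalGroup Q] [CompactSpace Q]
      [T2Space Q] [TotallyDisconnectedSpace Q] (p c e : ℕ) [Fact p.Prime], 0 < c →
      (∀ U : Subgroup Q, IsOpen (U : Set Q) → freeProlRank U p = ((c * U.index + e : ℕ) : ℕ∞)) →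
      IsElastic Q)
    {α : Type u} [Fintype α] (hα : 2 ≤ Fintype.card α) {ι : FreeGroup α →* P}
    (hι : IsProSigmaCompletion Sigma ι) (hS : ∃ ℓ ∈ Sigma, ℓ.Prime) : IsElastic P := by
  obtain ⟨ℓ, hℓS, hℓ⟩ := hS
  haveI : Fact ℓ.Prime := ⟨hℓ⟩
  exact hcrit P ℓ (Fintype.card α - 1) 1 (by omega) fun U hU =>
    freeProlRank_eq_of_isOpen_of_isProSigmaCompletion_freeGroup hι hℓS (by omega) U hU

/-- **The affine model of [AbsTopI] Prop 2.3 (i), elastic half**: for a hyperbolic type `(g, r)` with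
`r ≥ 1`, every pro-`Σ` completion `P` of the punctured surface group `Γ_{g,r}` (free of rank
`2g + r − 1 ≥ 2`), `Σ` containing a prime, is ELASTIC — given the affine rank criterion `hcrit`.
[cite: MochizukiAbsTopI2012, Prop 2.3 (i) p.19] -/
theorem isElastic_of_isProSigmaCompletion_puncturedSurfaceGroup_of_crit
    (hcrit : ∀ (Q : Type v) [Group Q] [TopologicalSpace Q] [IsTopologicalGroup Q] [CompactSpace Q]
      [T2Space Q] [TotallyDisconnectedSpace Q] (p c e : ℕ) [Fact p.Prime], 0 < c →
      (∀ U : Subgroup Q, IsOpen (U : Set Q) → freeProlRank U p = ((c * U.index + e : ℕ) : ℕ∞)) →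
      IsElastic Q)
    {g r : ℕ} (hr : 1 ≤ r) (h : PuncturedSurfaceGroup.IsHyperbolicType g r)
    {ι : PuncturedSurfaceGroup g r →* P} (hι : IsProSigmaCompletion Sigma ι)
    (hS : ∃ ℓ ∈ Sigma, ℓ.Prime) : IsElastic P := by
  classical
  obtain ⟨r', rfl⟩ : ∃ r', r = r' + 1 := ⟨r - 1, by omega⟩
  obtain ⟨e⟩ := PuncturedSurfaceGroup.nonempty_mulEquiv_freeGroup g r'
  -- `P` is a pro-`Σ` completion of the free group on `(Fin g × Bool) ⊕ Fin r'`
  have hι' : IsProSigmaCompletion Sigma (ι.comp e.symm.toMonoidHom) :=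
    hι.of_comp_mulEquiv e.symm (fun _ => rfl)
  have hcard : 2 ≤ Fintype.card ((Fin g × Bool) ⊕ Fin r') := by
    have hh : 2 < 2 * g + (r' + 1) := h
    simp only [Fintype.card_sum, Fintype.card_prod, Fintype.card_fin, Fintype.card_bool]
    omega
  exact isElastic_of_isProSigmaCompletion_freeGroup_of_crit hcrit hcard hι' hS

/-- **[AbsTopI] Prop 2.3 (i) at the affine model, both halves**: a pro-`Σ` completion of a hyperbolic
punctured surface group (`r ≥ 1`, `Σ` containing a prime) is slim (landed,
`isSlimGroup_of_isProSigmaCompletion_puncturedSurfaceGroup`) AND elastic (given `hcrit`).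
[cite: MochizukiAbsTopI2012, Prop 2.3 (i) p.19] -/
theorem slim_and_elastic_of_isProSigmaCompletion_puncturedSurfaceGroup_of_crit
    (hcrit : ∀ (Q : Type v) [Group Q] [TopologicalSpace Q] [IsTopologicalGroup Q] [CompactSpace Q]
      [T2Space Q] [TotallyDisconnectedSpace Q] (p c e : ℕ) [Fact p.Prime], 0 < c →
      (∀ U : Subgroup Q, IsOpen (U : Set Q) → freeProlRank U p = ((c * U.index + e : ℕ) : ℕ∞)) →
      IsElastic Q)
    {g r : ℕ} (hr : 1 ≤ r) (h : PuncturedSurfaceGroup.IsHyperbolicType g r)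
    {ι : PuncturedSurfaceGroup g r →* P} (hι : IsProSigmaCompletion Sigma ι)
    (hS : ∃ ℓ ∈ Sigma, ℓ.Prime) : IsSlimGroup P ∧ IsElastic P :=
  ⟨isSlimGroup_of_isProSigmaCompletion_puncturedSurfaceGroup hr h ι hι,
    isElastic_of_isProSigmaCompletion_puncturedSurfaceGroup_of_crit hcrit hr h hι hS⟩

/-! ### Unconditional forms: the affine rank criterion is abc-iut-L4-t15's
`isElastic_of_affine_rankFormula` (p422746), whose key lemma is `freeProlRank_le_add_of_sup_zpowers` -/

/-- **Pro-`Σ` completions of free groups of finite rank `≥ 2` are ELASTIC** (`Σ` containing a prime).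
[cite: MochizukiAbsTopI2012, Prop 2.3 (i) p.19] -/
theorem isElastic_of_isProSigmaCompletion_freeGroup {α : Type u} [Fintype α]
    (hα : 2 ≤ Fintype.card α) {ι : FreeGroup α →* P} (hι : IsProSigmaCompletion Sigma ι)
    (hS : ∃ ℓ ∈ Sigma, ℓ.Prime) : IsElastic P :=
  isElastic_of_isProSigmaCompletion_freeGroup_of_crit
    (fun _ _ _ _ _ _ _ p c e _ hc hRF => isElastic_of_affine_rankFormula p c e hc hRF) hα hι hS

/-- **[AbsTopI] Prop 2.3 (i), elastic half, at the AFFINE model**: every pro-`Σ` completion of a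
hyperbolic punctured surface group `Γ_{g,r}` (`r ≥ 1`; `Σ` containing a prime) is elastic.
[cite: MochizukiAbsTopI2012, Prop 2.3 (i) p.19] -/
theorem isElastic_of_isProSigmaCompletion_puncturedSurfaceGroup {g r : ℕ} (hr : 1 ≤ r)
    (h : PuncturedSurfaceGroup.IsHyperbolicType g r) {ι : PuncturedSurfaceGroup g r →* P}
    (hι : IsProSigmaCompletion Sigma ι) (hS : ∃ ℓ ∈ Sigma, ℓ.Prime) : IsElastic P :=
  isElastic_of_isProSigmaCompletion_puncturedSurfaceGroup_of_crit
    (fun _ _ _ _ _ _ _ p c e _ hc hRF => isElastic_of_affine_rankFormula p c e hc hRF) hr h hι hS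

/-- **[AbsTopI] Prop 2.3 (i) at the AFFINE model — "`Δ` is slim and elastic"** for `Δ` a pro-`Σ`
completion of a hyperbolic punctured surface group (`r ≥ 1`; `Σ` containing a prime): UNCONDITIONAL
(slim: `isSlimGroup_of_isProSigmaCompletion_puncturedSurfaceGroup`; elastic: the rank route).  The
closed-surface model (`r = 0`, `g ≥ 2`) is abc-iut-L4-d1's companion file.
[cite: MochizukiAbsTopI2012, Prop 2.3 (i) p.19] -/
theorem slim_and_elastic_of_isProSigmaCompletion_puncturedSurfaceGroup {g r : ℕ} (hr : 1 ≤ r)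
    (h : PuncturedSurfaceGroup.IsHyperbolicType g r) {ι : PuncturedSurfaceGroup g r →* P}
    (hι : IsProSigmaCompletion Sigma ι) (hS : ∃ ℓ ∈ Sigma, ℓ.Prime) : IsSlimGroup P ∧ IsElastic P :=
  ⟨isSlimGroup_of_isProSigmaCompletion_puncturedSurfaceGroup hr h ι hι,
    isElastic_of_isProSigmaCompletion_puncturedSurfaceGroup hr h hι hS⟩

end Elastic



end Literature.AnabelianGeometry.SemiGraphs.SemiGraphOfAnabelioids

end

-- build re-dispatch (comment-only re-land of p424779, 2026-08-26; author of record abc-iut-w5-d206 g2; filed by abc-iut-L4-t15 g5): content byte-identical above this line.
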